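import Literature.Computability.Complexity.EquivalenceProblemsFPNPProofs
import Literature.Computability.Complexity.OracleEmptyFP
import Literature.Computability.Complexity.GuardedBallStages
import HarnessLib

/-!
# `P = NP ⟹ PEq ⊆ LexEq(FP)` — discharge of `blassGurevich_LexEq_of_P_eq_NP`

Third proof file of `EquivalenceProblems.lean` (next to `EquivalenceProblemsProofs.lean` and
`EquivalenceProblemsFPNPProofs.lean`; it imports only the latter). It discharges the named fact

* `Literature.Computability.Complexity.blassGurevich_LexEq_of_P_eq_NP_holds :
  blassGurevich_LexEq_of_P_eq_NP` — "the above proof that `PEq ⊆ LexEq(FP^NP)` relativizes, so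
  all four polynomial-time classes of equivalence relations are equal in any world where
  `P = NP`" (Fortnow–Grochow 2011 = arXiv:0907.4775, §3, remark after Thm. 3.1; Blass–Gurevich
  1984, §1), unrelativized instance: `P = NP → PEq ⊆ LexEq(FP)`.

Proof, exactly as printed: by `blassGurevich_PEq_subset_LexEq_FPNP_holds`
(`EquivalenceProblemsFPNPProofs.lean`) the first canonical form `c` of `E ∈ PEq` is in `FP^A` for
some `A ∈ NP`; under `P = NP` the oracle `A` is in `P`, so its answer function is in `FP`
(`GuardedBall.ofLanguage_mem_FP_of_mem_P`) and `FP^A ⊆ FP` (`FPRel_subset_FP_of_mem_FP`,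
`OracleEmptyFP.lean`: a polynomial-time oracle gives no power).

Consequence recorded: with `canonicalForm_of_P_eq_NP` (`EquivalenceProblems.lean`) this yields the
route item `Summit.PneNP.PneNP.Theses.CanonicalForms.CanonOfPEqNP` (stmt-PneNP-0952) in its
inlined form (`canonicalForm_of_P_eq_NP'`), and it is the engine of the grounder's reduction of
`Summit.PneNP.PneNP.Theses.Descriptive.NoCanonGivesPneNP` (stmt-PneNP-9121) to `GI ∈ NP`.

## References

* A. Blass, Y. Gurevich, *Equivalence relations, invariants, and normal forms*, SIAM J. Comput.
  13 (1984) 682–689, §1 [BlassGurevich1984].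
* L. Fortnow, J. A. Grochow, *Complexity classes of equivalence problems revisited*, Inform.
  Comput. 209 (2011) 748–763 = arXiv:0907.4775, §3 (remark after Thm. 3.1) [FortnowGrochow2011].
-/

namespace Literature.Computability.Complexity

open _root_.Computability

/-- **Discharge of `blassGurevich_LexEq_of_P_eq_NP`**: if `P = NP` then every `P`-decidable
equivalence relation has its first canonical form in `FP` (`PEq ⊆ LexEq(FP)`): the `FP^NP` first
canonical form of Blass–Gurevich / Fortnow–Grochow §3 with its `NP` oracle now in `P`, hence
removable. [cite: FortnowGrochow2011, §3 (remark after Thm. 3.1)] -/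
theorem blassGurevich_LexEq_of_P_eq_NP_holds : blassGurevich_LexEq_of_P_eq_NP := by
  intro hPNP E hE
  obtain ⟨A, hA, c, hc, hfc⟩ := blassGurevich_PEq_subset_LexEq_FPNP_holds E hE
  have hAP : A ∈ Classes.P := by rw [hPNP]; exact hA
  exact ⟨hE.1, c, FPRel_subset_FP_of_mem_FP (GuardedBall.ofLanguage_mem_FP_of_mem_P hAP) hc, hfc⟩

/-- **`P = NP` gives every `P`-decidable equivalence relation an `FP` canonical form**, now
unconditionally in the fact (the inlined form of route item `CanonicalForms.CanonOfPEqNP`,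
stmt-PneNP-0952, via `canonicalForm_of_P_eq_NP`). [cite: FortnowGrochow2011, §3 (remark after Thm. 3.1)] -/
theorem canonicalForm_of_P_eq_NP' (hPNP : Classes.P = Nondeterministic.NP)
    (E : List Bool → List Bool → Prop) (hE : Equivalence E)
    (hP : ({w | ∃ x y, w = boolPair x y ∧ E x y} : Language Bool) ∈ Classes.P) :
    ∃ c ∈ FP, (∀ x, E (c x) x) ∧ ∀ x y, E x y → c x = c y :=
  canonicalForm_of_P_eq_NP blassGurevich_LexEq_of_P_eq_NP_holds hPNP E hE hP

end Literature.Computability.Complexity
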